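import Summits.Langlands.Langlands.Theses.QuarterDeficit1951
import Literature.NumberTheory.GaloisRepresentations.GaloisRepUnramifiedProofs
import Literature.NumberTheory.GaloisRepresentations.DoudMooreEvenIcosahedral
import Literature.NumberTheory.GaloisRepresentations.DirichletCharacterOfGaloisCharacter
import Literature.FieldTheory.AlgClosed.PadicAlgClEquivComplex
import Literature.NumberTheory.Automorphic.BCDTTheoremBWildAtThreeDet

/-!
Sketch for crux-ideate on `QuarterDeficit1951.IcosahedralSupply` (stmt-Langlands-15899),
ideator 2, round 1. First-lemma signatures of the two idea cards; not a skeleton.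
-/

noncomputable section

open scoped NumberField
open Field IsDedekindDomain
open Literature.NumberTheory.GaloisRepresentations Literature.NumberTheory.PAdicHodge

namespace Summit.Langlands.Langlands.Cruxes.IcosahedralSupply.Sketch

/-! ### Card `epsilon-uniform-derham`: the geometric conjunct off `ℓ = 1951` is free -/

/-- For EVERY `p`-adic Hodge datum (in particular Hilbert's `ε`-datum `RD.pst ℓ v hv`, with or
without `FontaineDatumExists`), a framed representation unramified at `v ∣ ℓ` is de Rham at `v`:
structure field `isDeRhamWith_of_isLocallyUnramified` + the proved bridge
`GaloisRep.isUnramifiedAt_iff_toLocal_holds`. -/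
theorem isDeRhamFramed_pst_of_isUnramifiedAt {ℓ : ℕ} [Fact ℓ.Prime] {n : ℕ}
    (RD : Summit.Langlands.ReciprocityData ℚ) (ρ : FramedGaloisRep ℚ (PadicAlgCl ℓ) n)
    (v : HeightOneSpectrum (𝓞 ℚ)) (hv : ((ℓ : ℕ) : 𝓞 ℚ) ∈ v.asIdeal)
    (h : ρ.IsUnramifiedAt v) : (RD.pst ℓ v hv).IsDeRhamFramed (ρ.toLocal v) := by
  apply PstWeilDeligneData.isDeRhamFramed_of_isLocallyUnramified
  intro σ hσ
  have h1 := (GaloisRep.isUnramifiedAt_iff_toLocal_holds v ρ.toGaloisRep).1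
    ((FramedGaloisRep.isUnramifiedAt_toGaloisRep_iff v ρ).2 h) σ hσ
  -- `h1 : ρ.toGaloisRep.toLocal v σ = 1`, an equality of linear maps; un-frame it
  have h2 : Matrix.toLin' (((ρ.toLocal v) σ : GL (Fin n) (PadicAlgCl ℓ)) :
      Matrix (Fin n) (Fin n) (PadicAlgCl ℓ)) = Matrix.toLin' 1 := by
    rw [Matrix.toLin'_one]
    refine LinearMap.ext fun w => ?_
    simpa using congr($h1 w)
  exact Units.ext (Matrix.toLin'.injective h2)

/-- Consequently the whole geometric conjunct of the crux at a prime `ℓ ≠ 1951` follows from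
"unramified at every `v` of residue characteristic `≠ 1951`" alone — no `p`-adic Hodge theory. -/
theorem isGeometricFramed_of_unramified_away {ℓ : ℕ} [Fact ℓ.Prime] {n : ℕ} (hℓ : ℓ ≠ 1951)
    (RD : Summit.Langlands.ReciprocityData ℚ) (ρ : FramedGaloisRep ℚ (PadicAlgCl ℓ) n)
    (hunr : ∀ v : HeightOneSpectrum (𝓞 ℚ), v.residueCard ≠ 1951 → ρ.IsUnramifiedAt v)
    (hcof : ∀ᶠ v : HeightOneSpectrum (𝓞 ℚ) in Filter.cofinite, ρ.IsUnramifiedAt v) :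
    Summit.Langlands.IsGeometricFramed RD ρ := by
  refine ⟨hcof, fun v hv => isDeRhamFramed_pst_of_isUnramifiedAt RD ρ v hv (hunr v ?_)⟩
  -- residue characteristic of `v ∣ ℓ` is `ℓ ≠ 1951`
  rw [Rat.residueCard_eq_of_natCast_mem (Fact.out) hv]
  exact hℓ

/-- The proposed Upgrade-path clause (F9) for `IsFontaineDatum`: finite-image representations
are de Rham (Fontaine, Astérisque 223, Exp. III §3: `B_dR^{Γ_{F'}} = F'` and Hilbert 90
descent; true for the genuine datum, NOT implied by (F1)–(F8)). -/
def FiniteImageIsDeRham {F : Type} [Field F] [ValuativeRel F] [TopologicalSpace F]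
    [IsNonarchimedeanLocalField F] {ℓ : ℕ} [Fact ℓ.Prime] (𝔇 : PstWeilDeligneData F ℓ) : Prop :=
  ∀ {n : ℕ} (ρ : FramedRep (absoluteGaloisGroup F) (PadicAlgCl ℓ) n),
    (Set.range ρ).Finite → 𝔇.IsDeRhamFramed ρ

/-- With (F9) in the specification, the `ℓ = 1951` instance of the geometric conjunct is one
line for any finite-image `ρ`. -/
theorem isDeRhamFramed_pst_of_finite {ℓ : ℕ} [Fact ℓ.Prime] {n : ℕ}
    (RD : Summit.Langlands.ReciprocityData ℚ) (ρ : FramedGaloisRep ℚ (PadicAlgCl ℓ) n)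
    (v : HeightOneSpectrum (𝓞 ℚ)) (hv : ((ℓ : ℕ) : 𝓞 ℚ) ∈ v.asIdeal)
    (hF9 : FiniteImageIsDeRham (RD.pst ℓ v hv)) (hfin : (Set.range ρ).Finite) :
    (RD.pst ℓ v hv).IsDeRhamFramed (ρ.toLocal v) :=
  hF9 _ (hfin.subset (by rintro _ ⟨σ, rfl⟩; exact ⟨_, rfl⟩))

/-! ### Card `iota-transport-conductor-one`: arithmetic conjuncts by transport from `ℂ` -/

/-- Transport of a finite-image framed representation along an arbitrary (discontinuous) ring
isomorphism is continuous because the kernel is open (`FramedArtinRep.isOpen_ker_toMonoidHom`). -/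
def transportAlong {ℓ : ℕ} [Fact ℓ.Prime] {n : ℕ} (ι : PadicAlgCl ℓ ≃+* ℂ)
    (ρ : FramedArtinRep ℚ n) : FramedGaloisRep ℚ (PadicAlgCl ℓ) n where
  toMonoidHom := (Matrix.GeneralLinearGroup.map (ι.symm : ℂ →+* PadicAlgCl ℓ)).comp ρ.toMonoidHom
  continuous_toFun := by
    sorry

/-- The icosahedral FINGERPRINT is pure group theory: in `A₅` every element has order
`1, 2, 3` or `5`, so the eigenvalue ratio of `ρ g` is a root of unity of that order and
`tr² / det ∈ {4, 0, 1, (3 ± √5)/2}`. -/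
theorem fingerprint_of_isIcosahedralType {R : Type*} [Field R] [IsAlgClosed R] [CharZero R]
    {G : Type*} [Group G] (ρ : G →* GL (Fin 2) R) (hρ : IsIcosahedralType ρ)
    (hfin : (Set.range ρ).Finite) (g : G) :
    let t := Matrix.trace ((ρ g : GL (Fin 2) R) : Matrix (Fin 2) (Fin 2) R)
    let d := Matrix.det ((ρ g : GL (Fin 2) R) : Matrix (Fin 2) (Fin 2) R)
    t ^ 2 = 0 ∨ t ^ 2 = d ∨ t ^ 2 = 4 * d ∨ t ^ 4 - 3 * d * t ^ 2 + d ^ 2 = 0 := by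
  sorry

/-- In-kernel check of the fingerprint algebra: a primitive 5th root of unity `ζ` gives
`t²/d = ζ + ζ⁻¹ + 2` a root of `x² - 3x + 1`; a primitive cube root gives `1`; `ζ = -1` gives `0`. -/
example {R : Type*} [Field R] (ζ : R) (h5 : ζ ^ 5 = 1) (h : ζ ^ 4 + ζ ^ 3 + ζ ^ 2 + ζ + 1 = 0) :
    (ζ + ζ ^ 4 + 2) ^ 2 - 3 * (ζ + ζ ^ 4 + 2) + 1 = 0 := by
  linear_combination (ζ ^ 3 + 2) * h5 + h

example {R : Type*} [Field R] (ζ : R) (h : ζ ^ 2 + ζ + 1 = 0) : ζ + ζ ^ 2 + 2 = 1 := by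
  linear_combination h

/-- CONDUCTOR-EXPONENT-ONE RIGIDITY (the load-bearing ℂ-side lemma): an even icosahedral
`ρ : Γ_ℚ → GL₂(ℂ)` of Artin conductor exactly `1951` whose inertia at `1951` has projective
image of order `5` (type 3a, Doud–Moore §2/§4) has determinant the Galois character of a
Dirichlet character mod `1951` of order `5`, read at arithmetic Frobenius
(`exists_isPrimitive_dirichletCharacter_of_isOpen_ker`, Kronecker–Weber proved in tree). -/
theorem det_order_five_of_conductor_1951 (ρ : FramedArtinRep ℚ 2)
    (heven : FramedGaloisRep.IsEven ρ) (hico : IsIcosahedralType ρ.toMonoidHom)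
    (hN : GaloisRep.artinConductorNat ρ.toGaloisRep = 1951)
    (h3a : ∀ (v : HeightOneSpectrum (𝓞 ℚ)), v.residueCard = 1951 →
      ∀ 𝔓 ∈ v.primesAbove, Nat.card (projectiveImage
        (ρ.toMonoidHom.restrict (𝔓.inertia (absoluteGaloisGroup ℚ)))) = 5) :
    ∃ χ₀ : DirichletCharacter ℂ 1951, orderOf χ₀ = 5 ∧
      ∀ v : HeightOneSpectrum (𝓞 ℚ), v.residueCard ≠ 1951 →
        ∀ 𝔓 ∈ v.primesAbove, ∀ σ : absoluteGaloisGroup ℚ, IsArithFrobAt (𝓞 ℚ) σ 𝔓 →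
          ((Matrix.GeneralLinearGroup.det (ρ σ) : ℂˣ) : ℂ) = (χ₀ (v.residueCard : ZMod 1951))⁻¹ := by
  sorry

end Summit.Langlands.Langlands.Cruxes.IcosahedralSupply.Sketch

end
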